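import Literature.NumberTheory.EllipticCurves.IsogenyFactorProofs
import Literature.NumberTheory.EllipticCurves.GaloisActionProofs
import Literature.NumberTheory.EllipticCurves.Greenberg1999.TwoTorsionMuInvariant
import HarnessLib

/-!
# A rational point of order `2` survives a `ℚ`-isogeny — stub 1 `stub_twoTorsionOfIsogenous` of line
# `regimes` on crux `StarOptB` (item stmt-BirchSwinnertonDyer-24445, route `EisensteinDepletionAtTwo`)

The registered stub (planner bsd-rank2-p2 GEN 25, skeleton `regimes.lean`):
`∀ (W W' : WeierstrassCurve ℚ) [W.IsElliptic] [W'.IsElliptic], IsIsogenous W W' →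
(∃ x, HasRationalTwoTorsionX W x) → ∃ x', HasRationalTwoTorsionX W' x'` — proved here as
`stub_twoTorsionOfIsogenous`, over the tree's isogeny library (an isogeny is a `Γ_ℚ`-equivariant
algebraic homomorphism `E(ℚ̄) →+ E'(ℚ̄)` with finite kernel).

Argument (Galois modules, no Tate module). Write `E[2] = E(ℚ̄)[2]`, `#E[2] = 4`
(`card_torsionPoints_eq_sq_holds`), and let `T ∈ E[2]` be the given `Γ_ℚ`-fixed point
(`exists_fixed_twoTorsion_of_hasRationalTwoTorsionX`). Take `j` maximal with `E[2^j] ⊆ ker φ`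
(it exists: `#E[2^j] = 4^j ≤ #ker φ < ∞`) and factor `φ = λ ∘ [2^j]` (Silverman III.4.11,
`Isogeny.exists_eq_comp_nsmul_of_geomTorsion_le_ker_holds'`); then `E[2] ⊄ ker λ`. If `λ T ≠ 0` it is a
fixed point of order `2` of `E'`. Otherwise pick `P₀ ∈ E[2] ∖ ker λ`; then `E[2] = {0, T, P₀, P₀ + T}`
(`twoTorsion_cases`), every `σ ∈ Γ_ℚ` maps `P₀` to `P₀` or `P₀ + T`, so `λ(σP₀) = λ P₀`: again a fixed
point of order `2` (`exists_fixed_twoTorsion_of_isogeny`). Galois descent of points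
(`InfiniteGalois.mem_range_algebraMap_iff_fixed`, as in `fixedPoints_eq_range_map_holds`) turns it
into a rational point with `2y + a₁x + a₃ = 0` (`hasRationalTwoTorsionX_of_fixed_twoTorsion`).

HONEST FRAMING: a transfer lemma (pure isogeny bookkeeping) for the skeleton of an OPEN crux; `StarOptB`
is not proved by it; nothing reads an analytic rank; BSD is not proved by any of this.

References: J. Silverman, *The Arithmetic of Elliptic Curves*, GTM 106 (2009), III.4.8, III.4.11,
III.6.4(b), VIII.§1 [SilvermanAEC2009].
-/

set_option linter.dupNamespace false
set_option autoImplicit false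

noncomputable section

open scoped Classical

open WeierstrassCurve Literature.NumberTheory.EllipticCurves
  Literature.NumberTheory.EllipticCurves.Greenberg1999

namespace Summit.BirchSwinnertonDyer.BirchSwinnertonDyer.Theorems.DepletionAtTwo

section TwoTorsionTransfer

variable (W W' : WeierstrassCurve ℚ)

/-! ### §1 Rational point of order 2 ⟶ `Γ_ℚ`-fixed point of order 2 on `E(ℚ̄)` -/

/-- A rational point of order `2` (`HasRationalTwoTorsionX W x`: a rational affine point `(x, y)` with
`2y + a₁x + a₃ = 0`) gives a nonzero `Γ_ℚ`-fixed geometric point `T` with `T + T = 0`.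
[cite: SilvermanAEC2009, VIII.§1 and III.2.3 (negation formula)] -/
theorem exists_fixed_twoTorsion_of_hasRationalTwoTorsionX [W.IsElliptic] {x : ℚ}
    (h : HasRationalTwoTorsionX W x) :
    ∃ T : W.geomPoints, T ≠ 0 ∧ T + T = 0 ∧ ∀ σ : Field.absoluteGaloisGroup ℚ, σ • T = T := by
  obtain ⟨y, heq, hy⟩ := h
  set f : ℚ →+* (AlgebraicClosure ℚ) := algebraMap ℚ (AlgebraicClosure ℚ) with hf
  have hfinj : Function.Injective f := (algebraMap ℚ (AlgebraicClosure ℚ)).injective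
  have hns : W.toAffine.Nonsingular x y := Affine.equation_iff_nonsingular.mp heq
  have hns' : (W.baseChange (AlgebraicClosure ℚ)).toAffine.Nonsingular (f x) (f y) :=
    (Affine.map_nonsingular W.toAffine hfinj x y).mpr hns
  refine ⟨(Affine.Point.some _ _ hns' : W.geomPoints), ?_, ?_, ?_⟩
  · intro h0
    cases h0
  · -- `-(x, y) = (x, -y - a₁x - a₃) = (x, y)`
    have h2 : 2 * f y + f W.a₁ * f x + f W.a₃ = 0 := by
      have := congrArg f hy
      simpa only [map_add, map_mul, map_ofNat, map_zero] using this
    have hneg : f y = (W.baseChange (AlgebraicClosure ℚ)).toAffine.negY (f x) (f y) := by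
      change f y = -f y - f W.a₁ * f x - f W.a₃
      linear_combination h2
    exact Affine.Point.add_self_of_Y_eq hneg
  · intro σ
    change Affine.Point.map ((show (AlgebraicClosure ℚ) ≃ₐ[ℚ] (AlgebraicClosure ℚ) from σ) : (AlgebraicClosure ℚ) →ₐ[ℚ] (AlgebraicClosure ℚ))
      (Affine.Point.some _ _ hns') = Affine.Point.some _ _ hns'
    rw [Affine.Point.map_some]
    congr 1 <;> exact AlgHom.commutes _ _

/-! ### §2 `Γ_ℚ`-fixed point of order 2 on `E(ℚ̄)` ⟶ rational point of order 2 (Galois descent) -/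

/-- A nonzero `Γ_ℚ`-fixed geometric point `T` with `T + T = 0` has rational coordinates `(x', y')` with
`2y' + a₁x' + a₃ = 0`, i.e. witnesses `HasRationalTwoTorsionX`. [cite: SilvermanAEC2009, VIII.§1 (proof of Prop. 1.2)] -/
theorem hasRationalTwoTorsionX_of_fixed_twoTorsion {T : W'.geomPoints} (h0 : T ≠ 0) (h2 : T + T = 0)
    (hfix : ∀ σ : Field.absoluteGaloisGroup ℚ, σ • T = T) : ∃ x' : ℚ, HasRationalTwoTorsionX W' x' := by
  -- `ℚ̄/ℚ` is Galois; stated for the `Algebra ℚ ℚ̄` instance found here (definitionally the construction's)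
  haveI : IsGalois ℚ (AlgebraicClosure ℚ) := by
    have h : @IsGalois ℚ _ (AlgebraicClosure ℚ) _ (AlgebraicClosure.instAlgebra ℚ) := {}
    exact h
  set f : ℚ →+* (AlgebraicClosure ℚ) := algebraMap ℚ (AlgebraicClosure ℚ) with hf
  have hfinj : Function.Injective f := (algebraMap ℚ (AlgebraicClosure ℚ)).injective
  change (W'.baseChange (AlgebraicClosure ℚ)).toAffine.Point at T
  rcases T with _ | ⟨X, Y, hXY⟩
  · exact absurd rfl h0
  · have hxy : ∀ σ : (AlgebraicClosure ℚ) ≃ₐ[ℚ] (AlgebraicClosure ℚ), σ X = X ∧ σ Y = Y := by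
      intro σ
      have := hfix σ
      change Affine.Point.map (σ : (AlgebraicClosure ℚ) →ₐ[ℚ] (AlgebraicClosure ℚ)) (Affine.Point.some X Y hXY) =
        Affine.Point.some X Y hXY at this
      rw [Affine.Point.map_some] at this
      simpa only [Affine.Point.some.injEq, AlgEquiv.coe_toAlgHom] using this
    obtain ⟨x', hx'⟩ := (InfiniteGalois.mem_range_algebraMap_iff_fixed X).mpr fun σ => (hxy σ).1
    obtain ⟨y', hy'⟩ := (InfiniteGalois.mem_range_algebraMap_iff_fixed Y).mpr fun σ => (hxy σ).2
    refine ⟨x', y', ?_, ?_⟩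
    · -- the equation descends
      have hE : (W'.baseChange (AlgebraicClosure ℚ)).toAffine.Equation (f x') (f y') := by
        rw [hf, hx', hy']; exact hXY.1
      exact (Affine.map_equation W'.toAffine hfinj x' y').mp hE
    · -- `T = -T` gives `Y = -Y - a₁X - a₃`, which descends
      have hneg : Affine.Point.some X Y hXY = -Affine.Point.some X Y hXY := add_eq_zero_iff_eq_neg.mp h2
      rw [Affine.Point.neg_some] at hneg
      have hY : Y = (W'.baseChange (AlgebraicClosure ℚ)).toAffine.negY X Y := (Affine.Point.some.inj hneg).2
      change Y = -Y - f W'.a₁ * X - f W'.a₃ at hY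
      rw [← hx', ← hy'] at hY
      apply hfinj
      have e : f (2 * y' + W'.a₁ * x' + W'.a₃) = 2 * f y' + f W'.a₁ * f x' + f W'.a₃ := by
        simp only [map_add, map_mul, map_ofNat]
      rw [map_zero, e]
      change algebraMap ℚ (AlgebraicClosure ℚ) y' = -algebraMap ℚ (AlgebraicClosure ℚ) y' - f W'.a₁ * algebraMap ℚ (AlgebraicClosure ℚ) x' - f W'.a₃ at hY
      rw [hf] at hY ⊢
      linear_combination hY

/-! ### §3 The structure of `E[2]`: four elements -/

/-- If `T, P₀ ∈ E(ℚ̄)` have order `2` with `P₀ ∉ {0, T}`, then every `Q` with `Q + Q = 0` is one of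
`0, T, P₀, P₀ + T` (`#E[2] = 4`, Silverman III.6.4(b), tree theorem `card_torsionPoints_eq_sq_holds`).
[cite: SilvermanAEC2009, Cor. III.6.4(b)] -/
theorem twoTorsion_cases [W.IsElliptic] {T P₀ Q : W.geomPoints} (hT : T + T = 0) (hP : P₀ + P₀ = 0)
    (hQ : Q + Q = 0) (hT0 : T ≠ 0) (hP0 : P₀ ≠ 0) (hPT : P₀ ≠ T) :
    Q = 0 ∨ Q = T ∨ Q = P₀ ∨ Q = P₀ + T := by
  -- the subgroup `E[2]` and its cardinality
  have hmem : ∀ R : W.geomPoints, R ∈ geomTorsion W ((2 : ℕ) : ℤ) ↔ R + R = 0 := fun R ↦ by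
    rw [AddSubgroup.torsionBy.nsmul_iff, two_nsmul]
  have hcard : Nat.card (geomTorsion W ((2 : ℕ) : ℤ)) = 4 := by
    have h := card_torsionPoints_eq_sq_holds W (AlgebraicClosure ℚ) (n := 2) (by norm_num)
    exact h
  haveI : Finite (geomTorsion W ((2 : ℕ) : ℤ)) := Nat.finite_of_card_ne_zero (by rw [hcard]; norm_num)
  letI : Fintype (geomTorsion W ((2 : ℕ) : ℤ)) := Fintype.ofFinite _
  have hTP : P₀ + T ≠ 0 := by
    intro h
    have : P₀ = -T := eq_neg_of_add_eq_zero_left h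
    rw [this] at hPT
    exact hPT ((neg_eq_of_add_eq_zero_left hT).symm ▸ rfl)
  have hTPT : P₀ + T ≠ T := fun h ↦ hP0 (by simpa using h)
  have hTPP : P₀ + T ≠ P₀ := fun h ↦ hT0 (by simpa using h)
  let e0 : geomTorsion W ((2 : ℕ) : ℤ) := ⟨0, (hmem 0).mpr (by simp)⟩
  let eT : geomTorsion W ((2 : ℕ) : ℤ) := ⟨T, (hmem T).mpr hT⟩
  let eP : geomTorsion W ((2 : ℕ) : ℤ) := ⟨P₀, (hmem P₀).mpr hP⟩
  let ePT : geomTorsion W ((2 : ℕ) : ℤ) := ⟨P₀ + T, (hmem _).mpr (by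
    calc P₀ + T + (P₀ + T) = (P₀ + P₀) + (T + T) := by abel
      _ = 0 := by rw [hP, hT, add_zero])⟩
  have h4 : ({e0, eT, eP, ePT} : Finset (geomTorsion W ((2 : ℕ) : ℤ))).card = 4 := by
    rw [Finset.card_insert_of_notMem, Finset.card_insert_of_notMem, Finset.card_insert_of_notMem,
      Finset.card_singleton]
    · simp only [Finset.mem_singleton, eP, ePT, Subtype.mk.injEq]
      exact hTPP.symm
    · simp only [Finset.mem_insert, Finset.mem_singleton, eT, eP, ePT, Subtype.mk.injEq, not_or]
      exact ⟨hPT.symm, hTPT.symm⟩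
    · simp only [Finset.mem_insert, Finset.mem_singleton, e0, eT, eP, ePT, Subtype.mk.injEq, not_or]
      exact ⟨hT0.symm, hP0.symm, hTP.symm⟩
  have huniv : ({e0, eT, eP, ePT} : Finset (geomTorsion W ((2 : ℕ) : ℤ))) = Finset.univ :=
    Finset.eq_univ_of_card _ (by rw [h4, ← Nat.card_eq_fintype_card, hcard])
  have hQmem : (⟨Q, (hmem Q).mpr hQ⟩ : geomTorsion W ((2 : ℕ) : ℤ)) ∈
      ({e0, eT, eP, ePT} : Finset (geomTorsion W ((2 : ℕ) : ℤ))) := huniv ▸ Finset.mem_univ _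
  simpa only [Finset.mem_insert, Finset.mem_singleton, e0, eT, eP, ePT, Subtype.mk.injEq] using hQmem

/-! ### §4 The transfer along an isogeny -/

/-- **A `Γ_ℚ`-fixed point of order `2` survives an isogeny over `ℚ`.** For elliptic `W, W'` over `ℚ`, an
isogeny `φ : W → W'` and a nonzero `Γ_ℚ`-fixed `T ∈ E(ℚ̄)` with `T + T = 0`, there is a nonzero
`Γ_ℚ`-fixed `T' ∈ E'(ℚ̄)` with `T' + T' = 0`. (Factor `φ = λ ∘ [2^j]` with `j` maximal such that
`E[2^j] ⊆ ker φ`; then `λ T` or, if `λ T = 0`, `λ P₀` for any `P₀ ∈ E[2] ∖ ker λ` is the witness.)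
[cite: SilvermanAEC2009, Cor. III.4.11, Cor. III.6.4(b), Thm. III.4.8] -/
theorem exists_fixed_twoTorsion_of_isogeny [W.IsElliptic] [W'.IsElliptic] (φ : Isogeny W W')
    {T : W.geomPoints} (hT0 : T ≠ 0) (hT2 : T + T = 0)
    (hTfix : ∀ σ : Field.absoluteGaloisGroup ℚ, σ • T = T) :
    ∃ T' : W'.geomPoints, T' ≠ 0 ∧ T' + T' = 0 ∧ ∀ σ : Field.absoluteGaloisGroup ℚ, σ • T' = T' := by
  -- `A j`: `E[2^j] ⊆ ker φ`
  let A : ℕ → Prop := fun j ↦ ∀ P ∈ geomTorsion W ((2 ^ j : ℕ) : ℤ), φ P = 0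
  have hA0 : A 0 := by
    intro P hP
    rw [AddSubgroup.torsionBy.nsmul_iff, pow_zero, one_nsmul] at hP
    rw [hP, map_zero]
  -- a maximal `j`
  obtain ⟨j, hj, hj'⟩ : ∃ j, A j ∧ ¬ A (j + 1) := by
    by_contra hcon
    push Not at hcon
    have hall : ∀ j, A j := fun j ↦ Nat.rec hA0 (fun k hk ↦ hcon k hk) j
    have hle : ∀ j, 4 ^ j ≤ Nat.card (φ.toAddMonoidHom.ker) := by
      intro j
      have hne : ((2 ^ j : ℕ) : AlgebraicClosure ℚ) ≠ 0 :=
        Nat.cast_ne_zero.mpr (pow_ne_zero j two_ne_zero)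
      have h1 : Nat.card (geomTorsion W ((2 ^ j : ℕ) : ℤ)) = (2 ^ j) ^ 2 :=
        card_torsionPoints_eq_sq_holds W (AlgebraicClosure ℚ) hne
      have h2 : Nat.card (geomTorsion W ((2 ^ j : ℕ) : ℤ)) ≤ Nat.card (φ.toAddMonoidHom.ker) :=
        Nat.card_mono φ.finite_ker fun P hP ↦ (AddMonoidHom.mem_ker).mpr (hall j P hP)
      calc 4 ^ j = (2 ^ j) ^ 2 := by rw [← pow_mul, mul_comm, pow_mul]; norm_num
        _ ≤ Nat.card (φ.toAddMonoidHom.ker) := h1 ▸ h2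
    exact absurd (hle _) (not_le.mpr (Nat.lt_pow_self (by norm_num)))
  -- factor `φ = lam ∘ [2^j]`
  have hne : ((2 ^ j : ℕ) : ℚ) ≠ 0 := Nat.cast_ne_zero.mpr (pow_ne_zero j two_ne_zero)
  obtain ⟨lam, hlam⟩ := Isogeny.exists_eq_comp_nsmul_of_geomTorsion_le_ker_holds' W W' hne φ hj
  -- a point `P₀ ∈ E[2]` off `ker lam`
  obtain ⟨P₁, hP₁, hP₁φ⟩ : ∃ P₁, P₁ ∈ geomTorsion W ((2 ^ (j + 1) : ℕ) : ℤ) ∧ φ P₁ ≠ 0 := by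
    by_contra h
    push Not at h
    exact hj' h
  set P₀ : W.geomPoints := (2 ^ j : ℕ) • P₁ with hP₀
  have hP₀2 : P₀ + P₀ = 0 := by
    rw [AddSubgroup.torsionBy.nsmul_iff, pow_succ, mul_nsmul, two_nsmul] at hP₁
    exact hP₁
  have hlamP₀ : lam P₀ ≠ 0 := by rw [hP₀, ← hlam]; exact hP₁φ
  -- the witness on `W'`: `lam Q` for a suitable `Q ∈ {T, P₀}`
  have hwit : ∀ Q : W.geomPoints, lam Q ≠ 0 → Q + Q = 0 →
      (∀ σ : Field.absoluteGaloisGroup ℚ, lam (σ • Q) = lam Q) →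
      ∃ T' : W'.geomPoints, T' ≠ 0 ∧ T' + T' = 0 ∧ ∀ σ : Field.absoluteGaloisGroup ℚ, σ • T' = T' := by
    intro Q hQ0 hQ2 hQfix
    refine ⟨lam Q, hQ0, by rw [← map_add, hQ2, map_zero], fun σ ↦ ?_⟩
    rw [← lam.map_smul, hQfix σ]
  by_cases hlamT : lam T = 0
  · -- `lam T = 0`: use `P₀`; `σ • P₀ ∈ {P₀, P₀ + T}`
    refine hwit P₀ hlamP₀ hP₀2 fun σ ↦ ?_
    have hP00 : P₀ ≠ 0 := fun h ↦ hlamP₀ (by rw [h, map_zero])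
    have hP0T : P₀ ≠ T := fun h ↦ hlamP₀ (by rw [h, hlamT])
    have hσ2 : σ • P₀ + σ • P₀ = 0 := by rw [← smul_add, hP₀2, smul_zero]
    rcases twoTorsion_cases W hT2 hP₀2 hσ2 hT0 hP00 hP0T with h | h | h | h
    · exact absurd (MulAction.injective σ (h.trans (smul_zero σ).symm)) hP00
    · exact absurd (MulAction.injective σ (h.trans (hTfix σ).symm)) hP0T
    · rw [h]
    · rw [h, map_add, hlamT, add_zero]
  · -- `lam T ≠ 0`: `lam T` itself
    exact hwit T hlamT hT2 fun σ ↦ by rw [hTfix σ]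

/-- **Stub 1 `stub_twoTorsionOfIsogenous` of line `regimes` (crux `StarOptB`, stmt-BirchSwinnertonDyer-24445),
verbatim:** a curve `ℚ`-isogenous to a curve with a rational point of order `2` has a rational point of
order `2`. [cite: SilvermanAEC2009, Cor. III.4.11, Cor. III.6.4(b), VIII.§1] -/
theorem stub_twoTorsionOfIsogenous :
    ∀ (W W' : WeierstrassCurve ℚ) [W.IsElliptic] [W'.IsElliptic],
      WeierstrassCurve.IsIsogenous W W' → (∃ x : ℚ, HasRationalTwoTorsionX W x) →
        ∃ x' : ℚ, HasRationalTwoTorsionX W' x' := by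
  intro W W' _ _ hiso hx
  obtain ⟨φ⟩ := hiso
  obtain ⟨x, hx⟩ := hx
  obtain ⟨T, hT0, hT2, hTfix⟩ := exists_fixed_twoTorsion_of_hasRationalTwoTorsionX W hx
  obtain ⟨T', hT'0, hT'2, hT'fix⟩ := exists_fixed_twoTorsion_of_isogeny W W' φ hT0 hT2 hTfix
  exact hasRationalTwoTorsionX_of_fixed_twoTorsion W' hT'0 hT'2 hT'fix

end TwoTorsionTransfer

end Summit.BirchSwinnertonDyer.BirchSwinnertonDyer.Theorems.DepletionAtTwo

end
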